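import Summits.AtomisticToContinuum.FouriersLaw.Theorems.BondHeatUncertaintyBoundedResponseBathHeatDCBand
import Summits.AtomisticToContinuum.FouriersLaw.Theorems.BondHeatUncertaintyBoundedResponseBathHeatOwedHeatPrice
import HarnessLib

/-!
# BondHeatUncertainty / BoundedResponse — «Octave» §1–§3: the octave identity `B^early_N(s) = 𝒲_N(s) − 𝒲_N(2s)/2`, the FREE sandwich
`−𝒲_N(2s)/2 ≤ B^early_N(s) ≤ 𝒲_N(s)` (variance positivity) and the OCTAVE INEQUALITY `t·γT²E_N ≤ 𝒲_N(2t)/2 − (B_N(2t) − B_N(t))`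
(`mul_escapeDeficit_le_of_octave`); the route statements (OR_g) `OctaveReturnFloor`, (OR♭_g) `LowOctaveReturnFloor`, (TRS) `ThoulessReturnSign`,
(TL_{κ,g}) `ThoulessLateFloor`, (TNM) `ThoulessNegMass` and the window bound (BHᵂ_h) `BathHeatWindow` with their tags; the point door
`(BHᴾ₁) ∧ (OR₁) ⟹ 11071`, the grade ladder (free at `g ≥ 2`, monotone) and ★ `(S) ⟹ (BHᵂ₁)` (`bathHeatWindow_one_of_subdiffusiveBondHeat`)
(decomp-a2c lens-1 g118, NODE 118 «Octave»; part 1 of 3; imports only the tree: NODE 117 `…BathHeatDCBand`, NODE 116 `…BathHeatOwedHeatPrice`;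
part B `…BathHeatOctaveB` = window doors / necessity / kernel hub; the main file `…BathHeatOctave` = late-window suppliers + the OVERVIEW docstring)

No `sorry`, no new axioms; the six `def … : Prop` are docstring-tagged ROUTE STATEMENTS of this cell, hypotheses of the doors, never asserted.
-/

open MeasureTheory ProbabilityTheory Filter Topology Set Function
open scoped NNReal ENNReal
open Literature.MathematicalPhysics.KineticTheory.HeatConduction
open Literature.MathematicalPhysics.KineticTheory OscillatorChain
open Literature.Probability.Process
open Summit.AtomisticToContinuum.FouriersLaw.Theorems.SubdiffusiveBondHeat
open Summit.AtomisticToContinuum.FouriersLaw.Theorems.SubdiffusiveBondHeat.EscapeGrading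
open Summit.AtomisticToContinuum.FouriersLaw.Theorems.BoundedResponse.TransientBand
open Summit.AtomisticToContinuum.FouriersLaw.Theorems.BoundedResponse.ParityFloor

namespace Summit.AtomisticToContinuum.FouriersLaw.Theorems.BoundedResponse.HeatSpreading

open Summit.AtomisticToContinuum.FouriersLaw.Theorems.BoundedResponse.TransientContact
open Summit.AtomisticToContinuum.FouriersLaw.Theses.BondHeatUncertainty (BoundedResponse SubdiffusiveBondHeat)

/-! ## §1 The octave increment and the free sandwich of the early piece by the (nonnegative) heat variance -/

section Algebra

variable (ω₂ lam β γ T : ℝ)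

/-- `B^late_N(t,t) = B_N(2t) − B_N(t)`: the OCTAVE INCREMENT of the bath tail functional is NODE 109's late functional at threshold = horizon
(charged lag weight `ℓ_{t,t}(r) = min(r,2t) − min(r,t)`, supported on `r ≥ t`). [formal bookkeeping] -/
theorem bathTailLate_self (N : ℕ) (t : ℝ) :
    bathTailLate ω₂ lam β γ T N t t = bathTail ω₂ lam β γ T N (2 * t) - bathTail ω₂ lam β γ T N t := by
  unfold bathTailLate bathTailEarly
  ring

/-- `B^late_N(t/2,t) = 2·(B_N(t) − B_N(t/2))`. [formal bookkeeping] -/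
theorem bathTailLate_half (N : ℕ) (t : ℝ) :
    bathTailLate ω₂ lam β γ T N (t / 2) t = 2 * (bathTail ω₂ lam β γ T N t - bathTail ω₂ lam β γ T N (t / 2)) := by
  unfold bathTailLate bathTailEarly
  rw [show (2 : ℝ) * (t / 2) = t by ring]
  ring

end Algebra

section Chain

variable {ω₂ lam β γ : ℝ} {T : ℝ}

section Pos

variable (hω : 0 < ω₂) (hl : 0 < lam) (hβ : 0 < β) (hγ : 0 < γ) (hT : 0 < T)
include hω hl hβ hγ hT

/-- `𝒲_N(t) ≤ 2γT²·t` (`N ≥ 1`, `t ≥ 0`): the thermodynamic ceiling of the contact heat variance. [formal bookkeeping] -/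
theorem bathHeatVar_le_linear {N : ℕ} (hN : 0 < N) {t : ℝ} (ht : 0 ≤ t) :
    bathHeatVar ω₂ lam β γ T N t ≤ 2 * (γ * T ^ 2) * t := by
  have h := bathHeatVar_eq_escapeDeficit_add_bathTail hω hl hβ hγ hT hN ht
  have hB := bathTail_le_mul_one_sub_escapeDeficit hω hl hβ hγ hT hN ht
  linarith

/-- ★ **The early piece is a DIFFERENCE OF HEAT VARIANCES**: `B^early_N(s) = 𝒲_N(s) − 𝒲_N(2s)/2` (`N ≥ 1`, `s ≥ 0`) — the response terms
`2t·γT²E_N` of `𝒲_N(t) = 2tγT²E_N + 2B_N(t)` cancel in `2B_N(s) − B_N(2s)`. [this cell] -/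
theorem bathTailEarly_eq_bathHeatVar {N : ℕ} (hN : 0 < N) {s : ℝ} (hs : 0 ≤ s) :
    bathTailEarly ω₂ lam β γ T N s = bathHeatVar ω₂ lam β γ T N s - bathHeatVar ω₂ lam β γ T N (2 * s) / 2 := by
  have h1 := bathHeatVar_eq_escapeDeficit_add_bathTail hω hl hβ hγ hT hN hs
  have h2 := bathHeatVar_eq_escapeDeficit_add_bathTail hω hl hβ hγ hT hN (by positivity : (0 : ℝ) ≤ 2 * s)
  unfold bathTailEarly
  linarith

/-- ★ **FREE TWO-SIDED SANDWICH of the early piece by variances**: `−𝒲_N(2s)/2 ≤ B^early_N(s) ≤ 𝒲_N(s)` (`N ≥ 2`, `s ≥ 0`; `𝒲_N ≥ 0`).  Unlike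
NODE 109's thermodynamic sandwich `|B^early_N(s)| ≤ 2γT²s` (useless at `s ≍ N²`) this one is `O(N)` on the whole (S)-window `s ≤ cN²/2`. [this cell] -/
theorem bathTailEarly_mem_Icc {N : ℕ} (hN : 1 < N) {s : ℝ} (hs : 0 ≤ s) :
    bathTailEarly ω₂ lam β γ T N s ∈ Icc (-(bathHeatVar ω₂ lam β γ T N (2 * s) / 2)) (bathHeatVar ω₂ lam β γ T N s) := by
  have h := bathTailEarly_eq_bathHeatVar hω hl hβ hγ hT (Nat.zero_lt_of_lt hN) hs
  have h1 := bathHeatVar_nonneg hω hl hβ hγ hN hT hs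
  have h2 := bathHeatVar_nonneg hω hl hβ hγ hN hT (by positivity : (0 : ℝ) ≤ 2 * s)
  exact ⟨by linarith, by linarith⟩

/-- ★ **The differenced identity**: `t·γT²E_N = 𝒲_N(t)/2 − B^early_N(s) − B^late_N(s,t)` (`N ≥ 1`, `t ≥ 0`, any `s`). [this cell] -/
theorem mul_escapeDeficit_eq_half_bathHeatVar_sub {N : ℕ} (hN : 0 < N) (s : ℝ) {t : ℝ} (ht : 0 ≤ t) :
    t * (γ * T ^ 2 * escapeDeficit ω₂ lam β γ T N) =
      bathHeatVar ω₂ lam β γ T N t / 2 - bathTailEarly ω₂ lam β γ T N s - bathTailLate ω₂ lam β γ T N s t := by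
  have h := bathHeatVar_eq_escapeDeficit_add_bathTail hω hl hβ hγ hT hN ht
  have e := bathTail_eq_early_add_late ω₂ lam β γ T N s t
  linarith

/-- ★ **The octave identity**: `t·γT²E_N = (𝒲_N(2t) − 𝒲_N(t))/2 − (B_N(2t) − B_N(t))` (`N ≥ 1`, `t ≥ 0`). [this cell] -/
theorem mul_escapeDeficit_eq_octave {N : ℕ} (hN : 0 < N) {t : ℝ} (ht : 0 ≤ t) :
    t * (γ * T ^ 2 * escapeDeficit ω₂ lam β γ T N) =
      (bathHeatVar ω₂ lam β γ T N (2 * t) - bathHeatVar ω₂ lam β γ T N t) / 2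
        - (bathTail ω₂ lam β γ T N (2 * t) - bathTail ω₂ lam β γ T N t) := by
  have h1 := bathHeatVar_eq_escapeDeficit_add_bathTail hω hl hβ hγ hT hN ht
  have h2 := bathHeatVar_eq_escapeDeficit_add_bathTail hω hl hβ hγ hT hN (by positivity : (0 : ℝ) ≤ 2 * t)
  linarith

/-- ★★ **THE OCTAVE INEQUALITY** (pointwise in `N ≥ 2`, `t ≥ 0`): `t·γT²E_N ≤ 𝒲_N(2t)/2 − (B_N(2t) − B_N(t))` — the response is bounded by the
heat variance at the DOUBLED horizon and the octave increment of the bath tail functional ALONE; every lag `r < t` is uncharged. [this cell] -/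
theorem mul_escapeDeficit_le_of_octave {N : ℕ} (hN : 1 < N) {t : ℝ} (ht : 0 ≤ t) :
    t * (γ * T ^ 2 * escapeDeficit ω₂ lam β γ T N) ≤
      bathHeatVar ω₂ lam β γ T N (2 * t) / 2 - (bathTail ω₂ lam β γ T N (2 * t) - bathTail ω₂ lam β γ T N t) := by
  have h := mul_escapeDeficit_eq_octave hω hl hβ hγ hT (Nat.zero_lt_of_lt hN) ht
  have h0 := bathHeatVar_nonneg hω hl hβ hγ hN hT ht
  linarith

/-- The octave increment as integrated OWED HEAT: `B_N(2t) − B_N(t) = γ² ∫_t^{2t} 𝒯_N(v) dv` (`t ≥ 0`; NODE 115). [formal bookkeeping] -/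
theorem bathTail_octave_eq_owedHeat (N : ℕ) {t : ℝ} (ht : 0 ≤ t) :
    bathTail ω₂ lam β γ T N (2 * t) - bathTail ω₂ lam β γ T N t = γ ^ 2 * ∫ v in t..(2 * t), owedHeat ω₂ lam β γ T N v :=
  bathTail_sub_eq hω hl hβ hγ hT N ht (by linarith)

end Pos

/-! ## §2 Route statements of this node (each `UNDECIDED · INSTRUMENTABLE`; none is a theorem of the tree) -/

/-- **(BHᵂ_h) `BathHeatWindow h`** — `∃ C, c > 0, N₀ ∀ N ≥ N₀ ∀ t ∈ [0, cN²]: 𝒲_N(t) ≤ C·N^h`: the contact heat variance is `O(N^h)` on a WHOLE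
Thouless window (not only at its end point, (BHᴾ_h) `BathHeatPoint h`).  FREE BENEATH (S) at `h = 1` (`bathHeatWindow_one_of_subdiffusiveBondHeat`:
(S) is itself a window statement, and the total-bond comparison holds at every `t`).  It is what makes the early piece `B^early_N(s)` FREE for every
threshold `s ≤ cN²/2` (`bathTailEarly_mem_Icc`).  Tags: beneath (S) PROVED here · unconditionally UNDECIDED (it implies (BHᴾ_h)). -/
def BathHeatWindow (h : ℝ) : Prop :=
  ∀ ω₂ lam β γ : ℝ, 0 < ω₂ → 0 < lam → 0 < β → 0 < γ → ∀ T : ℝ, 0 < T →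
    ∃ C c : ℝ, 0 < c ∧ ∃ N₀ : ℕ, ∀ N : ℕ, N₀ ≤ N → ∀ t ∈ Icc (0 : ℝ) (c * (N : ℝ) ^ 2),
      bathHeatVar ω₂ lam β γ T N t ≤ C * (N : ℝ) ^ h

/-- **(OR_g) `OctaveReturnFloor g`** — `∀ c > 0 ∃ C N₀ ∀ N ≥ N₀: B_N(2cN²) − B_N(cN²) ≥ −C·N^g`: the OCTAVE INCREMENT of the bath tail functional
across a Thouless octave `[cN², 2cN²]` (= `γ²∫_{cN²}^{2cN²} 𝒯_N`, the owed heat integrated over the octave; = `B^late_N(cN², cN²)`, NODE 109's late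
functional with threshold AT the Thouless scale) is bounded below at grade `g`.  THE RESIDUAL OF THIS NODE beneath (S) at `g = 1`
(`boundedResponse_of_subdiffusiveBondHeat_octaveReturnFloor`; indeed beneath the mere end-point bound (BHᴾ₁)).  Only lags `r ≥ cN²` are charged: the
residual is BLIND to the whole sub-Thouless range `r ≪ N²` (light cone, echo train at `r ≍ N`, everything) — where NODE 109's `LateTailFloor a 1 1`
charges all lags `r ≥ aN`.  NECESSARY given Ohm modulo the (S)-free ceiling (BTᶜ₁) (`octaveReturnFloor_of_boundedResponse_bathTailCeiling`);
implied by every one-sided supplier in the tree (`…_of_returnTailFloor` (g97 RT∞), `…_of_lateOvershootBudget` (NODE 115), `…_of_thoulessNegMass` ⟸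
`LateNegMass a` (NODE 109) / `BandNegMass` (NODE 117)); the converses fail as real-variable implications (a negative echo lobe of `K_N` at `r ≍ N` of
response mass `≫ 1/N`, repaid or not, is invisible to (OR) and violates each of them).  Why it might FAIL: persistent return-to-bath overshoot of the
contact step response AT THOULESS-SCALE lags (the slowest, diffusive relaxation mode overshooting equilibrium — excluded for a monotone/completely-monotone
late step response, which is the generic diffusive picture `𝒯_N(v) ≍ (T²/γ)(v^{-1/2} ∧ N e^{-Dv/N²}) ≥ 0`).  Tags: UNDECIDED · WEAKEST typed residual
beneath (S) in the lineage (mod (BTᶜ₁)) · phonon-TRUE (`K_N ≥ 0 ⟹ 𝒯_N ≥ 0`) · INSTRUMENTABLE (census OCTAVE-118: `[B_N(2t) − B_N(t)]/N` from the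
BKER-110 `W_N` tables) · IDEA-NEEDED (sign of the slowest relaxation mode of the pinned anharmonic chain + its N-uniform dominance at `v ≍ N²`). -/
def OctaveReturnFloor (g : ℝ) : Prop :=
  ∀ ω₂ lam β γ : ℝ, 0 < ω₂ → 0 < lam → 0 < β → 0 < γ → ∀ T : ℝ, 0 < T → ∀ c : ℝ, 0 < c →
    ∃ C : ℝ, ∃ N₀ : ℕ, ∀ N : ℕ, N₀ ≤ N →
      -(C * (N : ℝ) ^ g) ≤ bathTail ω₂ lam β γ T N (2 * (c * (N : ℝ) ^ 2)) - bathTail ω₂ lam β γ T N (c * (N : ℝ) ^ 2)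

/-- **(OR♭_g) `LowOctaveReturnFloor g`** — `∃ c₀ > 0 ∀ c ∈ (0, c₀] ∃ C N₀ ∀ N ≥ N₀: B_N(2cN²) − B_N(cN²) ≥ −C·N^g`: the octave floor asked only of
the LOW Thouless octaves (`c₀` may depend on the parameters).  THE WEAKEST TYPED RESIDUAL beneath (S) in the lineage: (S) ∧ (OR♭₁) ⟹ 11071
(`boundedResponse_of_subdiffusiveBondHeat_lowOctaveReturnFloor` — through the WINDOW bound (BHᵂ₁), which lets the door shrink its octave below both
`c₀` and the (S)-window); implied by (OR_g), and WITH CONSTANT `0` AT EVERY GRADE by the signed piece (TRS) below, hence by NODE 115's (OH_a) and by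
NODE 116's diffusive calibration floor (DF_{a,α}) for ANY exponent `α` (`lowOctaveReturnFloor_of_thoulessReturnSign`, `thoulessReturnSign_of_…`);
and EXACTLY NECESSARY: Ohm ∧ (BHᵂ₁) ⟹ (OR♭₁)
(`lowOctaveReturnFloor_of_boundedResponse_bathHeatWindow`), so beneath (S) `11071 ⟺ (OR♭₁)`
(`boundedResponse_iff_lowOctaveReturnFloor_of_subdiffusiveBondHeat`) — EXACT beneath (S) like NODE 107's (BT₁) and NODE 117's (BDF_θ) (and unlike
NODE 109's `LateTailFloor` or (OR₁), necessary only modulo the unproved ceiling (BTᶜ₁)), but CHARGING ONLY THOULESS-SCALE LAGS: beneath (S) the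
blocker is EQUIVALENT to a statement about the late octave increments of one scalar curve.  Why it might FAIL: as (OR_g), but now only an
overshoot that persists down to ARBITRARILY LOW Thouless fractions `cN²`, `c → 0` (after `N → ∞`) refutes it.  Tags: UNDECIDED · EXACT beneath (S) ·
WEAKEST · phonon-TRUE · INSTRUMENTABLE (OCTAVE-118) · IDEA-NEEDED. -/
def LowOctaveReturnFloor (g : ℝ) : Prop :=
  ∀ ω₂ lam β γ : ℝ, 0 < ω₂ → 0 < lam → 0 < β → 0 < γ → ∀ T : ℝ, 0 < T →
    ∃ c₀ : ℝ, 0 < c₀ ∧ ∀ c : ℝ, 0 < c → c ≤ c₀ →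
      ∃ C : ℝ, ∃ N₀ : ℕ, ∀ N : ℕ, N₀ ≤ N →
        -(C * (N : ℝ) ^ g) ≤ bathTail ω₂ lam β γ T N (2 * (c * (N : ℝ) ^ 2)) - bathTail ω₂ lam β γ T N (c * (N : ℝ) ^ 2)

/-- **(TRS) `ThoulessReturnSign`** — `∃ c₀ > 0 ∀ c > 0 ∃ N₀ ∀ N ≥ N₀ ∀ v ∈ [cN², c₀N²]: 𝒯_N(v) ≥ 0`: at the LOW THOULESS LAGS the contact step
response `θ_N` has NOT overshot its final value `1 − E_N` — the chain still OWES heat to the bath (`𝒯_N(v) = ∫_v^∞ K_N = (T²/γ)(1 − E_N − θ_N(v))`,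
NODE 115 `owedHeat_eq_stepResponse_gap`).  SIGNED and RATE-FREE (NODE 116's sign-or-rate law: a signed supplier pays no diffusive price); NODE 115's
(OH_a) `LateOwedHeatSign a` asks the same sign from the light cone `v ≥ aN` on, (TRS) only on `[cN², c₀N²]` — blind to the echo train at `v ≍ N`;
NODE 116's (DF_{a,α}) implies it for every `α` (`thoulessReturnSign_of_lateReturnFloor`).  `(TRS) ⟹ (OR♭_g)` with constant `0` at every grade,
so (S) ∧ (TRS) ⟹ 11071 (`boundedResponse_of_subdiffusiveBondHeat_thoulessReturnSign`).  Why it might FAIL: the slowest (diffusive, real) relaxation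
mode of the contact kinetic energy could be approached FROM ABOVE (overshoot) rather than from below — at fixed `N` the very-late sign of `𝒯_N` is
that of the slowest mode's amplitude, not controlled by any sum rule in the tree.  Tags: UNDECIDED · SIGNED · phonon-TRUE (`K_N ≥ 0`) ·
INSTRUMENTABLE (OWED-115 running tails at `v ≥ N²/8`; BKER-110 there is at the noise floor for `N ≥ 32`) · IDEA-NEEDED (a late maximum principle:
positivity of the coarse-grained return at Thouless times). -/
def ThoulessReturnSign : Prop :=
  ∀ ω₂ lam β γ : ℝ, 0 < ω₂ → 0 < lam → 0 < β → 0 < γ → ∀ T : ℝ, 0 < T →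
    ∃ c₀ : ℝ, 0 < c₀ ∧ ∀ c : ℝ, 0 < c → ∃ N₀ : ℕ, ∀ N : ℕ, N₀ ≤ N → ∀ v : ℝ,
      c * (N : ℝ) ^ 2 ≤ v → v ≤ c₀ * (N : ℝ) ^ 2 → 0 ≤ owedHeat ω₂ lam β γ T N v

/-- **(TL_{κ,g}) `ThoulessLateFloor κ g`** — `∀ c > 0 ∃ C N₀ ∀ N ≥ N₀: B^late_N(κ·cN², cN²) ≥ −C·N^g`: NODE 109's late functional with its threshold a
FIXED FRACTION `κ` of the horizon (NODE 109: threshold `aN`).  `(TL_{1/2,g}) ⟺ (OR_g)` (`thoulessLateFloor_half_iff_octaveReturnFloor`); for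
`0 < κ ≤ 1` a residual beneath (S) through the window bound (`boundedResponse_of_bathHeatWindow_thoulessLateFloor`); necessary given Ohm mod (BTᶜ_g)
(`thoulessLateFloor_of_bathTailFloor_bathTailCeiling`).  Tags: UNDECIDED · INSTRUMENTABLE · same failure mode as (OR_g). -/
def ThoulessLateFloor (κ g : ℝ) : Prop :=
  ∀ ω₂ lam β γ : ℝ, 0 < ω₂ → 0 < lam → 0 < β → 0 < γ → ∀ T : ℝ, 0 < T → ∀ c : ℝ, 0 < c →
    ∃ C : ℝ, ∃ N₀ : ℕ, ∀ N : ℕ, N₀ ≤ N →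
      -(C * (N : ℝ) ^ g) ≤ bathTailLate ω₂ lam β γ T N (κ * (c * (N : ℝ) ^ 2)) (c * (N : ℝ) ^ 2)

/-- **(TNM) `ThoulessNegMass`** — `∀ c > 0 ∃ C N₀ ∀ N ≥ N₀: (γ/T²)·∫_{(cN²,∞)} K_N⁻ ≤ C/N`: the NEGATIVE MASS of the boundary kernel BEYOND A
THOULESS-SCALE LAG is `O(1/N)` in response units.  The weakest ONE-SIDED (kernel-level) supplier of (OR₁) (`octaveReturnFloor_of_thoulessNegMass`);
implied by `LateNegMass a` (`a ≥ 0`, weight `min(r,cN²) = cN²` there) and by `BandNegMass` (weight `≥ 1/2` there) — NODES 109 / 117 charge all lags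
`r ≳ N`, (TNM) only `r ≳ N²`.  Why it might FAIL: as (OR_g), plus sign-indefinite but repaid oscillation of `K_N` at Thouless lags (which (OR) tolerates
and (TNM) does not).  Tags: UNDECIDED · phonon-TRUE · INSTRUMENTABLE (BKER-110 kernel tables: at `r ≳ N²/8` the measured `K_N` is at the noise floor for
`N ≥ 32` — consistent, uninformative). -/
def ThoulessNegMass : Prop :=
  ∀ ω₂ lam β γ : ℝ, 0 < ω₂ → 0 < lam → 0 < β → 0 < γ → ∀ T : ℝ, 0 < T → ∀ c : ℝ, 0 < c →
    ∃ C : ℝ, ∃ N₀ : ℕ, ∀ N : ℕ, N₀ ≤ N →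
      γ / T ^ 2 * ∫ r in Ioi (c * (N : ℝ) ^ 2), max (-(bathKinCorr ω₂ lam β γ T N r)) 0 ≤ C / N

/-! ## §3 Doors I: the point door (BHᴾ₁) ∧ (OR₁), the grade ladder, and the window bound (BHᵂ₁) beneath (S) -/

/-- (BHᵂ_h) ⟹ (BHᴾ_h) (the end point of the window). [formal bookkeeping] -/
theorem bathHeatPoint_of_bathHeatWindow {h : ℝ} (hW : BathHeatWindow h) : BathHeatPoint h := by
  intro ω₂ lam β γ hω hl hβ hγ T hT
  obtain ⟨C, c, hc, N₀, hCN⟩ := hW ω₂ lam β γ hω hl hβ hγ T hT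
  exact ⟨C, c, hc, N₀, fun N hN => hCN N hN _ ⟨by positivity, le_rfl⟩⟩

/-- ★★★ **THE OCTAVE DOOR: (BHᴾ₁) ∧ (OR₁) ⟹ 11071** — with `t = cN²/2` in the octave inequality, `(c/2)N²·γT²E_N ≤ 𝒲_N(cN²)/2 − (B_N(cN²) − B_N(cN²/2))
≤ (C/2 + C′)·N`.  No lag below `cN²/2` is charged to the residual. [this cell] -/
theorem boundedResponse_of_bathHeatPoint_octaveReturnFloor (hP : BathHeatPoint 1) (hF : OctaveReturnFloor 1) : BoundedResponse := by
  refine ohmicFloor_iff_boundedResponse.1 fun ω₂ lam β γ hω hl hβ hγ T hT => ?_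
  obtain ⟨C, c, hc, N₀, hCN⟩ := hP ω₂ lam β γ hω hl hβ hγ T hT
  obtain ⟨C', N₁, hC'⟩ := hF ω₂ lam β γ hω hl hβ hγ T hT (c / 2) (by positivity)
  refine ⟨(C / 2 + C') / (c / 2 * (γ * T ^ 2)), max N₀ (max N₁ 2), fun N hN => ?_⟩
  have hNN₀ : N₀ ≤ N := le_trans (le_max_left _ _) hN
  have hNN₁ : N₁ ≤ N := le_trans (le_trans (le_max_left _ _) (le_max_right _ _)) hN
  have hN2 : 2 ≤ N := le_trans (le_trans (le_max_right _ _) (le_max_right _ _)) hN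
  have hNpos : (0 : ℝ) < N := by exact_mod_cast (show 0 < N by omega)
  have hW := hCN N hNN₀
  have hB := hC' N hNN₁
  rw [Real.rpow_one] at hW hB
  have e2 : 2 * (c / 2 * (N : ℝ) ^ 2) = c * (N : ℝ) ^ 2 := by ring
  rw [e2] at hB
  have h := mul_escapeDeficit_le_of_octave hω hl hβ hγ hT (show 1 < N by omega) (t := c / 2 * (N : ℝ) ^ 2) (by positivity)
  rw [e2] at h
  have hcγ : 0 < c / 2 * (γ * T ^ 2) := by positivity
  rw [le_div_iff₀ hNpos, le_div_iff₀ hcγ]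
  have h4 : (N : ℝ) * (escapeDeficit ω₂ lam β γ T N * N * (c / 2 * (γ * T ^ 2))) ≤ N * (C / 2 + C') := by
    have e : (N : ℝ) * (escapeDeficit ω₂ lam β γ T N * N * (c / 2 * (γ * T ^ 2))) =
        c / 2 * (N : ℝ) ^ 2 * (γ * T ^ 2 * escapeDeficit ω₂ lam β γ T N) := by ring
    rw [e]
    nlinarith
  exact le_of_mul_le_mul_left h4 hNpos

/-- ★★★ **BENEATH (S): (S) ∧ (OR₁) ⟹ 11071** — the residual of this node.  (S) feeds (BHᴾ₁) (NODE 107); the residual charges only the Thouless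
octave `[cN²/2, cN²]` of lags. [this cell] -/
theorem boundedResponse_of_subdiffusiveBondHeat_octaveReturnFloor (hS : SubdiffusiveBondHeat) (hF : OctaveReturnFloor 1) : BoundedResponse :=
  boundedResponse_of_bathHeatPoint_octaveReturnFloor (bathHeatPoint_one_of_subdiffusiveBondHeat hS) hF

/-- (OR_g) is monotone in the grade (`N^g ≤ N^{g'}` for `N ≥ 1`). [formal bookkeeping] -/
theorem octaveReturnFloor_mono {g g' : ℝ} (hgg' : g ≤ g') (h : OctaveReturnFloor g) : OctaveReturnFloor g' := by
  intro ω₂ lam β γ hω hl hβ hγ T hT c hc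
  obtain ⟨C, N₀, hC⟩ := h ω₂ lam β γ hω hl hβ hγ T hT c hc
  refine ⟨max C 0, max N₀ 1, fun N hN => ?_⟩
  have hNN₀ : N₀ ≤ N := le_trans (le_max_left _ _) hN
  have hN1 : (1 : ℝ) ≤ N := by exact_mod_cast le_trans (le_max_right _ _) hN
  have h1 : (N : ℝ) ^ g ≤ (N : ℝ) ^ g' := Real.rpow_le_rpow_of_exponent_le hN1 hgg'
  have h2 := hC N hNN₀
  have h3 : C * (N : ℝ) ^ g ≤ max C 0 * (N : ℝ) ^ g' :=
    (mul_le_mul_of_nonneg_right (le_max_left C 0) (Real.rpow_nonneg (Nat.cast_nonneg N) g)).trans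
      (mul_le_mul_of_nonneg_left h1 (le_max_right C 0))
  linarith

section Pos

variable (hω : 0 < ω₂) (hl : 0 < lam) (hβ : 0 < β) (hγ : 0 < γ) (hT : 0 < T)
include hω hl hβ hγ hT

/-- The thermodynamic size of the octave increment: `B_N(2t) − B_N(t) ≥ −3γT²·t` (`N ≥ 2`, `t ≥ 0`; `B_N(2t) ≥ −2tγT²`, `B_N(t) ≤ tγT²(1 − E_N) ≤ tγT²`).
[formal bookkeeping] -/
theorem bathTail_octave_ge_thermo {N : ℕ} (hN : 1 < N) {t : ℝ} (ht : 0 ≤ t) :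
    -(3 * (γ * T ^ 2) * t) ≤ bathTail ω₂ lam β γ T N (2 * t) - bathTail ω₂ lam β γ T N t := by
  have h1 := (neg_mul_escapeDeficit_le_bathTail hω hl hβ hγ hT hN (t := 2 * t) (by positivity)).2
  have h2 := bathTail_le_mul_one_sub_escapeDeficit hω hl hβ hγ hT (Nat.zero_lt_of_lt hN) ht
  have hE := escapeDeficit_nonneg' hω hl hβ hγ hT (show 2 ≤ N from hN)
  nlinarith [mul_nonneg (mul_nonneg ht (by positivity : (0 : ℝ) ≤ γ * T ^ 2)) hE]

end Pos

/-- **THE FREE END OF THE LADDER: (OR_g) holds for every `g ≥ 2`** (thermodynamics: `B_N(2cN²) − B_N(cN²) ≥ −3cγT²·N²`); the door needs `g = 1`.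
[formal bookkeeping] -/
theorem octaveReturnFloor_of_two_le {g : ℝ} (hg : 2 ≤ g) : OctaveReturnFloor g := by
  refine octaveReturnFloor_mono hg fun ω₂ lam β γ hω hl hβ hγ T hT c hc => ⟨3 * (γ * T ^ 2) * c, 2, fun N hN => ?_⟩
  rw [Real.rpow_two]
  have h := bathTail_octave_ge_thermo hω hl hβ hγ hT (show 1 < N by omega) (t := c * (N : ℝ) ^ 2) (by positivity)
  linarith

/-- (OR_g) ⟹ (OR♭_g) (`c₀ = 1`, say). [formal bookkeeping] -/
theorem lowOctaveReturnFloor_of_octaveReturnFloor {g : ℝ} (h : OctaveReturnFloor g) : LowOctaveReturnFloor g :=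
  fun ω₂ lam β γ hω hl hβ hγ T hT => ⟨1, one_pos, fun c hc _ => h ω₂ lam β γ hω hl hβ hγ T hT c hc⟩

section Pos

variable (hω : 0 < ω₂) (hl : 0 < lam) (hβ : 0 < β) (hγ : 0 < γ) (hT : 0 < T)
include hω hl hβ hγ hT

/-- The (S)-window bound at one instance: for `N ≥ 2`, `0 ≤ t ≤ cN²`, a bond `b` with `b+1 < N` obeying (S) on `[1, cN²]` with constant `A`, the
total-bond comparison constant `C` and the bath/spread comparison constant `C′`: `𝒲_N(t) ≤ (4A√c + 8C + 4C′ + 2γT²)·N`. [formal bookkeeping] -/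
theorem bathHeatVar_le_of_window_bond {A c C C' : ℝ} (hc : 0 < c) (hC0 : 0 ≤ C) (hC'0 : 0 ≤ C') (hA0 : 0 ≤ A) {N : ℕ} (hN : 2 ≤ N) {b : ℕ}
    (hC : ∀ t : ℝ, 0 ≤ t → heatSpread ω₂ lam β γ T N t ≤ 2 * ((N : ℝ) - 1) ^ 2 * gibbsBondHeatVar (pinnedChain ω₂ lam β γ) T N b t + C * (N : ℝ) ^ 3)
    (hC' : ∀ t : ℝ, 0 ≤ t → ((N : ℝ) - 1) ^ 2 * bathHeatVar ω₂ lam β γ T N t ≤ 2 * heatSpread ω₂ lam β γ T N t + C' * (N : ℝ) ^ 3)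
    (hVb : ∀ t : ℝ, 1 ≤ t → t ≤ c * (N : ℝ) ^ 2 → gibbsBondHeatVar (pinnedChain ω₂ lam β γ) T N b t ≤ A * Real.sqrt t)
    {t : ℝ} (ht0 : 0 ≤ t) (htc : t ≤ c * (N : ℝ) ^ 2) :
    bathHeatVar ω₂ lam β γ T N t ≤ (4 * A * Real.sqrt c + 8 * C + 4 * C' + 2 * (γ * T ^ 2)) * N := by
  have hNpos : (0 : ℝ) < N := by exact_mod_cast (show 0 < N by omega)
  have hN2 : (2 : ℝ) ≤ N := by exact_mod_cast hN
  have hM : (0 : ℝ) < ((N : ℝ) - 1) ^ 2 := by nlinarith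
  have hsc : 0 ≤ Real.sqrt c := Real.sqrt_nonneg c
  rcases lt_or_ge t 1 with ht1 | ht1
  · have h1 := bathHeatVar_le_linear hω hl hβ hγ hT (show 0 < N by omega) ht0
    have h2 : 2 * (γ * T ^ 2) * t ≤ 2 * (γ * T ^ 2) * N := by
      have hγT : 0 ≤ 2 * (γ * T ^ 2) := by positivity
      exact mul_le_mul_of_nonneg_left (by linarith) hγT
    have h3 : 0 ≤ (4 * A * Real.sqrt c + 8 * C + 4 * C') * N :=
      mul_nonneg (add_nonneg (add_nonneg (mul_nonneg (mul_nonneg (by norm_num) hA0) hsc) (mul_nonneg (by norm_num) hC0))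
        (mul_nonneg (by norm_num) hC'0)) hNpos.le
    linarith
  · have hSb := hVb t ht1 htc
    have hTb := hC t ht0
    have hWb := hC' t ht0
    have hsqrt : Real.sqrt t ≤ Real.sqrt c * N := by
      calc Real.sqrt t ≤ Real.sqrt (c * (N : ℝ) ^ 2) := Real.sqrt_le_sqrt htc
        _ = Real.sqrt c * N := by rw [Real.sqrt_mul hc.le, Real.sqrt_sq hNpos.le]
    have hN3 : (N : ℝ) ^ 3 ≤ 4 * ((N : ℝ) - 1) ^ 2 * N := by nlinarith
    have hgb : gibbsBondHeatVar (pinnedChain ω₂ lam β γ) T N b t ≤ A * (Real.sqrt c * N) :=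
      hSb.trans (mul_le_mul_of_nonneg_left hsqrt hA0)
    -- M·𝒲 ≤ 2V + C'N³ ≤ 4M·A√c·N + (2C + C')N³ ≤ M·(4A√c + 8C + 4C')·N
    have key : ((N : ℝ) - 1) ^ 2 * bathHeatVar ω₂ lam β γ T N t ≤
        ((N : ℝ) - 1) ^ 2 * ((4 * A * Real.sqrt c + 8 * C + 4 * C') * N) := by
      nlinarith [mul_le_mul_of_nonneg_left hgb (by positivity : (0 : ℝ) ≤ 4 * ((N : ℝ) - 1) ^ 2),
        mul_le_mul_of_nonneg_left hN3 (by positivity : (0 : ℝ) ≤ 2 * C + C')]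
    have key' := le_of_mul_le_mul_left key hM
    nlinarith [mul_nonneg (by positivity : (0 : ℝ) ≤ 2 * (γ * T ^ 2)) hNpos.le]

end Pos

/-- ★★ **(S) ⟹ (BHᵂ₁): the heat variance is `O(N)` on the WHOLE Thouless window** — (S) bounds one bond's Gibbs heat variance by `A√t ≤ A√c·N` for
`1 ≤ t ≤ cN²`; the total-bond comparison (`totalBondComparison_holds`, NODE 105/106) and the bath/spread comparison (`heatSpread_bathHeatVar_compare`)
hold at every `t ≥ 0`; `t < 1` is thermodynamic (`𝒲_N(t) ≤ 2γT²t`). [this cell] -/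
theorem bathHeatWindow_one_of_subdiffusiveBondHeat (hS : SubdiffusiveBondHeat) : BathHeatWindow 1 := by
  intro ω₂ lam β γ hω hl hβ hγ T hT
  have hS' := hS ω₂ lam β γ hω hl hβ hγ T hT
  simp only [] at hS'
  obtain ⟨A, c, hc, N₀, hA⟩ := hS'
  obtain ⟨C, hC⟩ := totalBondComparison_holds ω₂ lam β γ hω hl hβ hγ T hT
  obtain ⟨C', hC'⟩ := heatSpread_bathHeatVar_compare hω hl hβ hγ hT
  refine ⟨4 * max A 0 * Real.sqrt c + 8 * max C 0 + 4 * max C' 0 + 2 * (γ * T ^ 2), c, hc, max N₀ 2, fun N hN t ht => ?_⟩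
  have hNN₀ : N₀ ≤ N := le_trans (le_max_left _ _) hN
  have hN2 : 2 ≤ N := le_trans (le_max_right _ _) hN
  obtain ⟨b, hb, hVb⟩ := hA N hNN₀
  rw [Real.rpow_one]
  refine bathHeatVar_le_of_window_bond hω hl hβ hγ hT (A := max A 0) (C := max C 0) (C' := max C' 0) hc (le_max_right _ _)
    (le_max_right _ _) (le_max_right _ _) hN2 (b := b)
    (fun s hs => (hC N b hb s hs).trans ?_) (fun s hs => ((hC' N (by omega) s hs).2).trans ?_) (fun s h1 h2 => ?_) ht.1 ht.2
  · exact add_le_add le_rfl (mul_le_mul_of_nonneg_right (le_max_left C 0) (pow_nonneg (Nat.cast_nonneg N) 3))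
  · exact add_le_add le_rfl (mul_le_mul_of_nonneg_right (le_max_left C' 0) (pow_nonneg (Nat.cast_nonneg N) 3))
  · have h := hVb s h1 h2
    have h' : gibbsBondHeatVar (pinnedChain ω₂ lam β γ) T N b s ≤ A * Real.sqrt s := by
      simpa [gibbsBondHeatVar, gibbsBondCorr] using h
    exact h'.trans (mul_le_mul_of_nonneg_right (le_max_left _ _) (Real.sqrt_nonneg _))

end Chain

end Summit.AtomisticToContinuum.FouriersLaw.Theorems.BoundedResponse.HeatSpreading
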